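/-
Copyright: lit-balaban cell, Phase-2 proof seat p02 (gen 8).  Statement-level skeleton of a published paper; no proof claims beyond what
the kernel checks below.
-/
import Literature.MathematicalPhysics.QuantumFieldTheory.BalabanImbrieJaffe1984to88.BIJ88Ineq555W3CorrTorus
import Literature.MathematicalPhysics.QuantumFieldTheory.BalabanImbrieJaffe1984to88.BIJ88Ineq547W2Torus
import Literature.MathematicalPhysics.QuantumFieldTheory.BalabanImbrieJaffe1984to88.BIJ88Sect2SigmaAllTori
import Literature.MathematicalPhysics.QuantumFieldTheory.BalabanImbrieJaffe1984to88.BIJ88Decay223CkAllTori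
import Literature.MathematicalPhysics.QuantumFieldTheory.BalabanImbrieJaffe1984to88.BIJ85Prop12AllTori

/-!
# `BalabanImbrieJaffe1984to88.BIJ88Sect5KernelsAllTori` — T. Bałaban, J. Imbrie, A. Jaffe, *Effective action and cluster properties of the
abelian Higgs model*, Commun. Math. Phys. **114** (1988) 257–315 [BalabanImbrieJaffe1988]: **(5.4.7) for `w₂` and (5.5.5) for `w′₃`, `w″₃`
ON THE TORI OF THE SERIES FOR THE KERNELS OF RECORD — OVER ALL TORI, HYPOTHESIS-FREE**: the per-tower torus theorems of this seat
(`BIJ88Ineq547W2Torus.ineq547_w2_torus` p305806, `BIJ88Ineq555W3Torus.ineq555_w3prime_torus` p306045, `BIJ88Ineq555W3CorrTorus.ineq555_w3corr_torus`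
/ `ineq555_w3_torus` p308103) re-assembled with ONE `c > 0` and ONE radius threshold valid for EVERY torus `T_η` with `P.d = d`, `P.L = L` and
EVERY scale `k ≤ m + K` (print, p. 260/262: constants *"independent of k, T_η"*; the cell's typing note G-C1-07), and with the one standing
input of those files — [6I] Proposition 1.2 by its tree name — DISCHARGED by p19's `BIJ85Prop12AllTori.prop12Printed_allTori` (from
p37/p38's theorem): assuming only `2 ≤ d`, `L` odd `> 1`, `a > 0`.

statement-level skeleton of published theorems with citation tags; proofs where landed; nothing here is a claim about the Yang–Mills mass gap

PDF held: `paper:balaban1988-cmp114-bij-abelian-higgs-effective-action` (journal page = PDF page + 256); p. 282 [PDF 26] and p. 284 [PDF 28]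
read this session as images (`HOME/lit-balaban-r16/renders/cmp114/original-p026-x2.png`, `-p028-x2.png`).

CITATION HEADER (lean-in-tree rule).  Part of the lit-balaban TYPED SKELETON (HOME `run/shared/lean/pub/lit-balaban/`), Phase-2 proof seat
p02 (gen 8), unit `lit-balaban-p02-g8`; WHAT IS REPRODUCED = SKELETON rows **C2.Eq5.4.7** (member (5.4.7) for `w₂`) and **C2.Eq5.5.5**
((5.5.5) for `w′₃`, `w″₃`), owner r16, referee ref-5, kind «model instance for the kernels of record, all-tori hypothesis-free shape»
(TAKING line HOME/STATUS.md, gen 8 sixth file).  Decls of record used BY NAME (nothing restated): this seat's `ineq547_of_close` (p305806),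
`abs_w3p_le`/`ineq555_of_members` (p306045), `abs_w3corr_le_explicit`/`lip_cutoff_torus`/`exists_lipschitz_cutoffProfile` (p306809/p308103);
p08's `BIJ88Decay223CkAllTori.close226_allTori_of_prop12Printed` ((2.26) over all tori; hypothesis-free with `prop12Printed_allTori`, as in p08 g9's `BIJ88Sect2DkLocCkAllToriHolds.close226_allTori`); r18 g10's
`BIJ88Sect2SigmaAllTori.close218_allTori_of_prop12Printed` ((2.18) over all tori) and `exists_gradB_allTori_of_prop12Printed` (the `|∇H|`
member of (I.7.2.2) over all tori and all scales); p16/p19's `BIJ85Sect72AllTori.exists_absH_le_allTori_of_prop12Printed` (the `|H|` member,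
scales `≥ 1`) and `abs_H_zero_le` (scale `0`: `H₀ = I`), `BIJ85Prop12AllTori.prop12Printed_allTori`; p08 g7's
`BIJ88Ineq217Ineq722Torus.curl_HkE_single_eq`, `BIJ88HkLocTorus.ofLp_HkE_single_bond`; p33's `BIJ85Claim73ActualOne.sum_abs_curl_single_le`;
p13's `BIJ88Cutoffs21.cutoff`/`isCutoff_cutoff`/`cutoff_mem_Icc`; r18's `Close`/`loc`/`trunc`; r16's `Ineq547`/`Ineq555`.

THE PRINTED TEXT (verbatim).  p. 282: *"where w₂ = Λ̄₃^{(k)}C_{k,loc} − Λ̄₃^{(k)}C_k□ satisfies a bound |w₂(x,b)| ≦ exp(−cr(e_k))exp(−c dist(x,b)),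
(5.4.7)"*.  p. 284: *"The ½r(e_k)-cube □ is centered near the plaquette that we are evaluating σ_{k,loc}∂Λ₂^{(k)*}A^{(k)} at. The kernels w′₃, w″₃
have range less than ½r(e_k), and we have |w′₃(p,b)|, |w″₃(p,b)| ≦ e^{−cr(e_k)}. (5.5.5)"*.  p. 260 (2.5)/(2.7) and p. 262 (2.16)–(2.18),
(2.26): the constants `c` are printed without dependence on `k` or on the torus ([6I] Prop. 1.2, p. 35: *"independent of k, T_η"*).

WHAT IS PROVED (0 `sorry`, standard axioms; theorems only — proof lane; `2 ≤ d`, `L` odd `> 1`, `a > 0`, NO other hypothesis):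
* §1 **`ineq547_w2_allTori`** — `∃ c > 0, r₁` such that for EVERY torus `P` (`P.d = d`, `P.L = L`), EVERY `k ≤ m + K`, every `r ≥ r₁`, `|χ₃| ≤ 1`,
  column-wise cubes: r16's `Ineq547 (TSite P 0) (PBond P k) w₂ distEU c r` for `w₂ = Λ̄₃(C_{k,loc} − C_k□)`, `C_k` = p08's `CkE`, `C_{k,loc}` =
  its (2.25) localization — §1 of p305806 fed with (2.26) over all tori.
* §2 **`ineq555_w3prime_allTori`** — `∃ c > 0, R₁`, for every torus, scale, radius `R ≥ R₁`, `|c_∂| ≤ 1`, `|χ₂|, |χ□| ≤ 1`, all `p, b`: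
  `|w′₃(p,b)| ≤ e^{−cR}` for `w′₃ = (σ_{k,loc} − σ_k)∂Λ₂□` of p306045 — its mechanism `abs_w3p_le` fed with (2.18) over all tori.
* §3 **`ineq555_w3corr_allTori`** — `∃ c > 0, r₁`, for every torus, scale, `w > 0`, `c′ ≠ 0`, `r ≥ r₁`, `|χ₂|, |χ□| ≤ 1` with the cube clause
  `□(p) ⊇ {b : |p₋ − b₋|_∞ ≤ r/8 + 2}`, all `p, b`: `|(w″₃ − w′₃)(p,b)| ≤ e^{−cr}` — `abs_w3corr_le_explicit` of p308103 fed with the `|H|` and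
  `|∇H|` members of (I.7.2.2) over all tori (the curl of the column through `curl_HkE_single_eq`).
* §4 **`ineq555_w3_allTori`** — r16's `Ineq555 (TPlaq P k) (PBond P k) w′₃ w″₃ c r` for EVERY torus and scale with ONE `(c, r₁)`.
HONEST SCOPE.  (i) Exactly the per-tower statements of p305806/p306045/p308103 with the order of quantifiers strengthened (constants before the
torus) and `h12` discharged; readings (`Λ̄₃`, `Λ₂` contractions, `□` column-wise resp. row-wise with the containment clause, (2.14) truncation and (2.1)/(2.25)
cutoffs at radius `r`) as there.  (ii) Constants explicit functions of the all-tori (2.18)/(2.26)/(I.7.2.2) constants, not print's; `U = 1` real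
abelian fields; standing range.  (iii) No `def`, no new named fact: theorems only; NOT summit progress.  Unit `lit-balaban-p02-g8`
(literature-prover-lit-balaban-p02-g8-0), 2026-08-21.
-/

open scoped BigOperators RealInnerProductSpace

namespace Literature.MathematicalPhysics.QuantumFieldTheory.BalabanImbrieJaffe1984to88.BIJ88Sect5KernelsAllTori

open Balaban1983to89 hiding Site Plaq
open Balaban1983to89.LatticeFieldCalculus
open BIJ88Ineq217NearPart (pdist pdist_nonneg)
open BIJ85Prop521Torus BIJ85Sigma421Torus BIJ85Prop522Torus
open BIJ85Sect7Statements BIJ85Ineq722Torus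
open BIJ85Ineq722DeltaA (deltaAData)
open BIJ88Sect2Statements (Close trunc loc IsCutoff)
open BIJ88Sect5StatementsPart2 (Ineq547 Ineq555)
open BIJ88Cutoffs21 (cutoff isCutoff_cutoff cutoff_mem_Icc)
open BIJ88Eq220Torus (CkE)
open BIJ85Eq224Base0 (torusEdgeCellsTo)
open BIJ88Ineq217Ineq722Torus (curl_HkE_single_eq)
open BIJ88HkLocTorus (ofLp_HkE_single_bond)
open BIJ85Claim73ActualOne (sum_abs_curl_single_le)
open BIJ85Sect72AllTori (exists_absH_le_allTori_of_prop12Printed abs_H_zero_le)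
open BIJ85Prop12AllTori (prop12Printed_allTori)
open BIJ88Sect2SigmaAllTori (close218_allTori_of_prop12Printed exists_gradB_allTori_of_prop12Printed)
open BIJ88Decay223CkAllTori (close226_allTori_of_prop12Printed)
open BIJ88Ineq547W2Torus (ineq547_of_close)
open BIJ88Ineq555W3Torus (abs_w3p_le ineq555_of_members)
open BIJ88Ineq555W3CorrMechanism (exists_lipschitz_cutoffProfile lip_cutoff_torus)
open BIJ88Ineq555W3CorrTorus (abs_w3corr_le_explicit)

open Balaban1983to89 renaming Site → TSite, Plaq → TPlaq

noncomputable section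

/-! ## §0  Elementary plumbing -/

/-- `x ≤ e^x` in the form `c₀ ≤ γr ⟹ c₀ ≤ e^{γr}`. [folklore] -/
private theorem le_exp_of_le {c₀ t : ℝ} (h : c₀ ≤ t) : c₀ ≤ Real.exp t :=
  h.trans (by linarith [Real.add_one_le_exp t])

/-- `c₀e^{−2γr} ≤ e^{−γr}` once `c₀ ≤ e^{γr}`. [folklore] -/
private theorem prefactor_absorb' {c₀ γ r : ℝ} (h : c₀ ≤ Real.exp (γ * r)) :
    c₀ * Real.exp (-(2 * γ) * r) ≤ Real.exp (-(γ * r)) := by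
  have e : Real.exp (-(2 * γ) * r) = Real.exp (-(γ * r)) * Real.exp (-(γ * r)) := by
    rw [← Real.exp_add]; ring_nf
  rw [e, ← mul_assoc]
  have h1 : c₀ * Real.exp (-(γ * r)) ≤ 1 := by
    have h2 := mul_le_mul_of_nonneg_right h (Real.exp_pos (-(γ * r))).le
    rw [← Real.exp_add, show γ * r + -(γ * r) = 0 by ring, Real.exp_zero] at h2
    exact h2
  exact (mul_le_mul_of_nonneg_right h1 (Real.exp_pos _).le).trans (by rw [one_mul])

/-- `0 ≤ dist(x, y)`. [folklore] -/
private theorem distEU_nonneg'' {P : Params} (k : ℕ) (x : TSite P 0) (y : TSite P k) : 0 ≤ distEU P k x y :=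
  div_nonneg (Nat.cast_nonneg _) (pow_nonneg (Nat.cast_nonneg _) _)

/-- `A ≤ γR ⟹ Ae^{−2γR} ≤ e^{−γR}`. [folklore] -/
private theorem small_of_le_mul' {A γ R : ℝ} (h : A ≤ γ * R) :
    A * Real.exp (-(2 * γ) * R) ≤ Real.exp (-(γ * R)) :=
  prefactor_absorb' (le_exp_of_le h)

/-- `Ae^{−δr/16} ≤ e^{−(δ/32)r}` once `r ≥ 32A/δ`. [folklore] -/
private theorem small_of_le'' {A δ r : ℝ} (hδ : 0 < δ) (hr : 32 * A / δ ≤ r) :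
    A * Real.exp (-(δ * (r / 16))) ≤ Real.exp (-(δ / 32 * r)) := by
  have h1 : A ≤ δ / 32 * r := by rw [div_le_iff₀ hδ] at hr; linarith
  have h := small_of_le_mul' h1
  have e1 : -(2 * (δ / 32)) * r = -(δ * (r / 16)) := by ring
  rwa [e1] at h

/-! ## §1  (5.4.7) for `w₂` over all tori -/

/-- **(5.4.7) FOR `w₂ = Λ̄₃(C_{k,loc} − C_k□)` OVER ALL TORI, HYPOTHESIS-FREE** (`2 ≤ d`, `L` odd `> 1`, `a > 0`): ONE `c > 0` and ONE threshold
`r₁` such that for EVERY torus `P` (`P.d = d`, `P.L = L`), EVERY `k ≤ m + K`, every `r ≥ r₁`, every `|χ₃| ≤ 1` and column-wise cube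
`χ□(b,b) = 1`: r16's `Ineq547 (TSite P 0) (PBond P k) w₂ distEU c r` — `|w₂(x,b)| ≤ e^{−cr}e^{−c dist(x,b)}` — for the `C_k` of record (p08's
`CkE`) and its (2.25) localization; (2.26) over all tori (`close226_allTori_of_prop12Printed` ∘ `prop12Printed_allTori`) into p305806's `ineq547_of_close`; `c = δ′/16`,
`r₁ = max(4R₀, 16c₀/δ′)`. [cite: BalabanImbrieJaffe1988, (5.4.7) p.282] -/
theorem ineq547_w2_allTori {d L : ℕ} (hd : 2 ≤ d) (hL : Odd L ∧ 1 < L) {a : ℝ} (ha : 0 < a) :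
    ∃ c r₁ : ℝ, 0 < c ∧ ∀ (P : Params) (_ : P.d = d) (_ : P.L = L) (hdP : 2 ≤ P.d) (k : ℕ) (_ : k ≤ P.m + P.K) (r : ℝ), r₁ ≤ r →
      ∀ (χ₃ : TSite P 0 → ℝ), (∀ x, |χ₃ x| ≤ 1) → ∀ (χb : PBond P k → PBond P k → ℝ), (∀ b, χb b b = 1) →
        Ineq547 (TSite P 0) (PBond P k)
          (fun x b =>
            χ₃ x * loc (cutoff (r / 4) (r / 2) fun (x : TSite P 0) (b' : PBond P k) => distEU P k x b'.src)
                (fun x b' => CkE P hdP ((P.eta k) ^ P.d) ((P.L : ℝ) ^ k) k (toEj P k (Pi.single b' 1)) x) x b -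
              χ₃ x * CkE P hdP ((P.eta k) ^ P.d) ((P.L : ℝ) ^ k) k (toEj P k (Pi.single b 1)) x * χb b b)
          (fun x b => distEU P k x b.src) c r := by
  obtain ⟨R₀, c₀, δ', hδ', hc₀, h226⟩ := close226_allTori_of_prop12Printed hd hL ha (prop12Printed_allTori d L ha)
  refine ⟨δ' / 16, max (4 * R₀) (16 * c₀ / δ'), by positivity, ?_⟩
  intro P hPd hPL hdP k hk r hr χ₃ hχ₃ χb hχb
  have hr4 : 4 * R₀ ≤ r := (le_max_left _ _).trans hr
  have hr16 : 16 * c₀ / δ' ≤ r := (le_max_right _ _).trans hr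
  have hclose := h226 P hPd hPL hdP k hk r hr4
  have hc₀r : c₀ ≤ δ' / 16 * r := by
    rw [div_le_iff₀ hδ'] at hr16
    nlinarith
  have hε : c₀ * Real.exp (-(δ' / 2) * (r / 4)) ≤ Real.exp (-(δ' / 16 * r)) := by
    have h := prefactor_absorb' (le_exp_of_le hc₀r)
    have e : -(2 * (δ' / 16)) * r = -(δ' / 2) * (r / 4) := by ring
    rwa [e] at h
  have hcδ : δ' / 16 ≤ δ' / 2 := by linarith
  have key := ineq547_of_close (α := TSite P 0) (β := PBond P k) (dist := fun x b => distEU P k x b.src)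
    (Cloc := loc (cutoff (r / 4) (r / 2) fun (x : TSite P 0) (b' : PBond P k) => distEU P k x b'.src)
      (fun x b' => CkE P hdP ((P.eta k) ^ P.d) ((P.L : ℝ) ^ k) k (toEj P k (Pi.single b' 1)) x))
    (Ck := fun x b' => CkE P hdP ((P.eta k) ^ P.d) ((P.L : ℝ) ^ k) k (toEj P k (Pi.single b' 1)) x)
    (fun x b => distEU_nonneg'' k x b.src) hclose hε hcδ hχ₃ hχb
  intro x b
  exact key x b

/-! ## §2  (5.5.5) for `w′₃` over all tori -/

/-- **(5.5.5) FOR `w′₃ = (σ_{k,loc} − σ_k)∂Λ₂^{(k)*}□` OVER ALL TORI, HYPOTHESIS-FREE**: ONE `c > 0`, ONE threshold `R₁` such that for EVERY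
torus `P` (`P.d = d`, `P.L = L`), EVERY `k ≤ m + K`, every truncation radius `R ≥ R₁`, `|c_∂| ≤ 1`, `|χ₂| ≤ 1`, `|χ□| ≤ 1`, all `p, b`:
`|w′₃(p,b)| ≤ e^{−cR}` for the `σ_k` of record (p30's `sigmaTorus`) — p306045's mechanism `abs_w3p_le` fed with (2.18) over all tori
(`close218_allTori_of_prop12Printed` ∘ `prop12Printed_allTori`) and p33's curl column count; `c = δ′/4`, `R₁ = max(R₀, 16dc₀/δ′)`.
[cite: BalabanImbrieJaffe1988, (5.5.5) p.284] -/
theorem ineq555_w3prime_allTori {d L : ℕ} (hd : 2 ≤ d) (hL : Odd L ∧ 1 < L) {a : ℝ} (ha : 0 < a) :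
    ∃ c R₁ : ℝ, 0 < c ∧ ∀ (P : Params) (_ : P.d = d) (_ : P.L = L) (hdP : 2 ≤ P.d) (k : ℕ)
      (_ : k ≤ P.m + P.K) (R : ℝ), R₁ ≤ R → ∀ (cD : ℝ), |cD| ≤ 1 → ∀ (χ₂ : PBond P k → ℝ), (∀ b, |χ₂ b| ≤ 1) →
      ∀ (χb : TPlaq P k → PBond P k → ℝ), (∀ p b, |χb p b| ≤ 1) → ∀ (p : TPlaq P k) (b : PBond P k),
        |(∑ p', (trunc pdist R (fun p q => sigmaTorus (P := P) hdP ((P.eta k) ^ P.d) ((P.L : ℝ) ^ k) k (toU P k (Pi.single q 1)) p) p p'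
              - sigmaTorus (P := P) hdP ((P.eta k) ^ P.d) ((P.L : ℝ) ^ k) k (toU P k (Pi.single p' 1)) p) *
            curl cD (fun b' => if b' = b then (1 : ℝ) else 0) p') * χ₂ b * χb p b| ≤ Real.exp (-(c * R)) := by
  obtain ⟨R₀, c₀, δ', hδ', hc₀, h218⟩ := close218_allTori_of_prop12Printed hd hL ha (prop12Printed_allTori d L ha)
  have hd0 : (0 : ℝ) < d := by exact_mod_cast (by omega : 0 < d)
  refine ⟨δ' / 4, max R₀ (16 * d * c₀ / δ'), by positivity, ?_⟩
  intro P hPd hPL hdP k hk R hR cD hcD χ₂ hχ₂ χb hχb p b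
  have hR0 : R₀ ≤ R := (le_max_left _ _).trans hR
  have hR1 : 16 * d * c₀ / δ' ≤ R := (le_max_right _ _).trans hR
  have h := abs_w3p_le (α := TPlaq P k) (β := PBond P k) (dist := pdist) (fun p p' => pdist_nonneg p p')
    (σloc := trunc pdist R fun p q => sigmaTorus (P := P) hdP ((P.eta k) ^ P.d) ((P.L : ℝ) ^ k) k (toU P k (Pi.single q 1)) p)
    (σ := fun p q => sigmaTorus (P := P) hdP ((P.eta k) ^ P.d) ((P.L : ℝ) ^ k) k (toU P k (Pi.single q 1)) p)
    (h218 P hPd hPL hdP k hk R hR0) (by positivity)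
    (D := fun p' b => curl cD (fun b' => if b' = b then (1 : ℝ) else 0) p')
    (sum_abs_curl_single_le cD b) (hχ₂ b) (hχb p b) p
  refine h.trans ?_
  have hdd : (P.d : ℝ) = d := by exact_mod_cast hPd
  have h1 : c₀ * Real.exp (-(δ' / 2) * R) * (4 * P.d * |cD|) ≤ (4 * d * c₀) * Real.exp (-(2 * (δ' / 4)) * R) := by
    have e : -(2 * (δ' / 4)) * R = -(δ' / 2) * R := by ring
    rw [e, hdd]
    have hcD' : 4 * (d : ℝ) * |cD| ≤ 4 * d * 1 := by gcongr
    have hexp : 0 < Real.exp (-(δ' / 2) * R) := Real.exp_pos _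
    nlinarith [mul_nonneg hc₀ hexp.le]
  have hA : 4 * d * c₀ ≤ δ' / 4 * R := by
    rw [div_le_iff₀ hδ'] at hR1
    nlinarith
  exact h1.trans (small_of_le_mul' hA)

/-! ## §3  (5.5.5) for the correction `w″₃ − w′₃` over all tori -/

/-- **(5.5.5) FOR `w″₃ − w′₃ = Q^e_k∂^η(H_kΛ₂□ − H_{k,loc}Λ₂)` OVER ALL TORI, HYPOTHESIS-FREE**: ONE `c > 0`, ONE threshold `r₁` such that for
EVERY torus `P` (`P.d = d`, `P.L = L`), EVERY `k ≤ m + K`, every `c′ ≠ 0`, `w > 0`, `r ≥ r₁`, `|χ₂| ≤ 1`, `|χ□| ≤ 1` with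
`□(p) ⊇ {b : |p₋ − b₋|_∞ ≤ r/8 + 2}`, all `p, b`: `|(Q^e_k∂^ηG_b)(p)χ₂(b)| ≤ e^{−cr}` (`H_k` = p11's `HkE` kernel, `H_{k,loc} = ζ_kH_k` with p13's
(2.1) cutoff) — p308103's `abs_w3corr_le_explicit` fed with the `|H|` and `|∇H|` members of (I.7.2.2) over ALL tori and ALL scales
(`exists_absH_le_allTori_of_prop12Printed` + `abs_H_zero_le`, `exists_gradB_allTori_of_prop12Printed`; `prop12Printed_allTori`), the curl of the
column read through `curl_HkE_single_eq`; `c = δ/32`, `δ = min(δ_H, δ_∇)`. [cite: BalabanImbrieJaffe1988, (5.5.5) p.284] -/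
theorem ineq555_w3corr_allTori {d L : ℕ} (hd : 2 ≤ d) (hL : Odd L ∧ 1 < L) {a : ℝ} (ha : 0 < a) :
    ∃ c r₁ : ℝ, 0 < c ∧ ∀ (P : Params) (_ : P.d = d) (_ : P.L = L) (hdP : 2 ≤ P.d) (k : ℕ) (_ : k ≤ P.m + P.K)
      (c' : ℝ), c' ≠ 0 → ∀ (w : ℝ), 0 < w → ∀ (r : ℝ), r₁ ≤ r →
      ∀ (χ₂ : PBond P k → ℝ), (∀ b, |χ₂ b| ≤ 1) → ∀ (χb : TPlaq P k → PBond P k → ℝ), (∀ p b, |χb p b| ≤ 1) →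
      (∀ p b, (supDist p.src b.src : ℝ) ≤ r / 8 + 2 → χb p b = 1) →
        ∀ (p : TPlaq P k) (b : PBond P k),
          |(torusEdgeCellsTo P 0 k k (Nat.zero_add k) hdP).Q
              (curl ((P.L : ℝ) ^ k) (fun b'' =>
                WithLp.ofLp (HkE P w c' k (toEj P k (Pi.single b 1))) b'' * χb p b -
                  loc (cutoff (r / 16) (r / 8) (fun (b'' : PBond P 0) (b' : PBond P k) => distEU P k b''.src b'.src))
                    (fun b'' b' => WithLp.ofLp (HkE P w c' k (toEj P k (Pi.single b' 1))) b'') b'' b)) p * χ₂ b| ≤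
            Real.exp (-(c * r)) := by
  have hd1 : 1 ≤ d := by omega
  have h12 := prop12Printed_allTori d L ha
  obtain ⟨δg, Mg, hδg, hMg, hG⟩ := exists_gradB_allTori_of_prop12Printed hd1 hL ha h12
  obtain ⟨δh, Mh, hδh, hMh, hH1⟩ := exists_absH_le_allTori_of_prop12Printed hd1 hL ha h12
  obtain ⟨C, hC, hLip₀⟩ := exists_lipschitz_cutoffProfile
  set δ := min δg δh with hδdef
  set M := max Mg Mh with hMdef
  have hδ : 0 < δ := lt_min hδg hδh
  have hM1 : 1 ≤ M := hMh.trans (le_max_right _ _)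
  have hM0 : 0 ≤ M := zero_le_one.trans hM1
  have hA : 0 ≤ (2 + 3 * C * Real.exp δ) * M := by positivity
  refine ⟨δ / 32, max 16 (32 * ((2 + 3 * C * Real.exp δ) * M) / δ), by positivity, ?_⟩
  intro P hPd hPL hdP k hk c' hc' w hw r hr χ₂ hχ₂ χb hχb hbox p b
  have hr16 : 16 ≤ r := (le_max_left _ _).trans hr
  have hrA : 32 * ((2 + 3 * C * Real.exp δ) * M) / δ ≤ r := (le_max_right _ _).trans hr
  have hr0 : 0 < r := by linarith
  -- uniform exponential comparison
  have hexp : ∀ {δ₁ : ℝ} {t : ℝ}, δ ≤ δ₁ → 0 ≤ t → Real.exp (-(δ₁ * t)) ≤ Real.exp (-(δ * t)) := fun h ht =>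
    Real.exp_le_exp.2 (by nlinarith)
  -- the `|H|` member at this torus and scale (scale 0: `H₀ = I`)
  have hH : ∀ (b' : PBond P k) (b'' : PBond P 0),
      |WithLp.ofLp (HkE P w c' k (toEj P k (Pi.single b' 1))) b''| ≤ M * Real.exp (-(δ * distEU P k b''.src b'.src)) := by
    intro b' b''
    rw [ofLp_HkE_single_bond hk hc' hw ha b'' b']
    rcases Nat.eq_zero_or_pos k with hk0 | hk1
    · subst hk0
      exact abs_H_zero_le hk ha hM1 δ b''.dir b'.dir b''.src b'.src
    · calc |(torusRep P k (deltaAData hk a)).H (b''.src, b''.dir) (b'.src, b'.dir)|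
          ≤ Mh * Real.exp (-(δh * distEU P k b''.src b'.src)) := hH1 P hPd hPL k hk1 hk b''.dir b'.dir b''.src b'.src
        _ ≤ M * Real.exp (-(δ * distEU P k b''.src b'.src)) :=
            mul_le_mul (le_max_right _ _) (hexp (min_le_right _ _) (distEU_nonneg'' k _ _)) (Real.exp_pos _).le hM0
  -- the gradient member: the η-curl of the column is a difference of two gradient components
  have hcurl : ∀ (b' : PBond P k) (q : TPlaq P 0),
      |curl ((P.L : ℝ) ^ k) (WithLp.ofLp (HkE P w c' k (toEj P k (Pi.single b' 1)))) q| ≤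
        2 * M * Real.exp (-(δ * distEU P k q.src b'.src)) := by
    intro b' q
    rw [curl_HkE_single_eq hk hc' hw ha ((P.L : ℝ) ^ k) b' q]
    have hcomp : ∀ (ν' lam : Fin P.d),
        |(P.L : ℝ) ^ k * ((torusRep P k (deltaAData hk a)).H (q.src.shift lam, ν') (b'.src, b'.dir) -
            (torusRep P k (deltaAData hk a)).H (q.src, ν') (b'.src, b'.dir))| ≤ M * Real.exp (-(δ * distEU P k q.src b'.src)) := by
      intro ν' lam
      have h1 := norm_le_pi_norm (fun lam : Fin P.d => (P.L : ℝ) ^ k *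
        ((torusRep P k (deltaAData hk a)).H (q.src.shift lam, ν') (b'.src, b'.dir) -
          (torusRep P k (deltaAData hk a)).H (q.src, ν') (b'.src, b'.dir))) lam
      rw [Real.norm_eq_abs] at h1
      refine h1.trans ((hG P hPd hPL k hk ν' b'.dir q.src b'.src).trans ?_)
      exact mul_le_mul (le_max_left _ _) (hexp (min_le_left _ _) (distEU_nonneg'' k _ _)) (Real.exp_pos _).le hM0
    have h2 := hcomp q.ν q.μ
    have h3 := hcomp q.μ q.ν
    refine (abs_sub _ _).trans ?_
    linarith
  have key := abs_w3corr_le_explicit hdP hk (H := fun b' => WithLp.ofLp (HkE P w c' k (toEj P k (Pi.single b' 1))))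
    hδ.le hM0 hH hcurl hr0 hC.le (isCutoff_cutoff (show r / 16 < r / 8 by linarith) _) (cutoff_mem_Icc _ _ _)
    (fun x x' lam lam' b' hxx' => lip_cutoff_torus hC.le hr16 (hLip₀ (r / 16) (r / 8) (by linarith)) x x' lam lam' b' hxx')
    hχ₂ hχb hbox p b
  exact key.trans (small_of_le'' hδ hrA)

/-! ## §4  (5.5.5), both kernels, over all tori -/

/-- **(5.5.5) OVER ALL TORI, BOTH KERNELS — r16's TYPED LEAF WITH ONE PAIR OF CONSTANTS FOR EVERY TORUS AND SCALE**: `∃ c > 0, r₁` such that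
for EVERY torus `P` (`P.d = d`, `P.L = L`), EVERY `k ≤ m + K`, every `c′ ≠ 0`, `w > 0`, `r ≥ r₁`, `|c_∂| ≤ 1`, `|χ₂| ≤ 1`, `|χ□| ≤ 1` with the cube
clause: `Ineq555 (TPlaq P k) (PBond P k) w′₃ w″₃ c r` for `w′₃ = (σ_{k,loc} − σ_k)∂Λ₂□` and `w″₃ = w′₃ + Q^e_k∂^η(H_kΛ₂□ − H_{k,loc}Λ₂)` of record —
*"|w′₃(p,b)|, |w″₃(p,b)| ≦ e^{−cr(e_k)}"*, hypothesis-free. [cite: BalabanImbrieJaffe1988, (5.5.5) p.284] -/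
theorem ineq555_w3_allTori {d L : ℕ} (hd : 2 ≤ d) (hL : Odd L ∧ 1 < L) {a : ℝ} (ha : 0 < a) :
    ∃ c r₁ : ℝ, 0 < c ∧ ∀ (P : Params) (_ : P.d = d) (_ : P.L = L) (hdP : 2 ≤ P.d) (k : ℕ)
      (_ : k ≤ P.m + P.K) (c' : ℝ), c' ≠ 0 → ∀ (w : ℝ), 0 < w → ∀ (r : ℝ), r₁ ≤ r →
      ∀ (cD : ℝ), |cD| ≤ 1 → ∀ (χ₂ : PBond P k → ℝ), (∀ b, |χ₂ b| ≤ 1) → ∀ (χb : TPlaq P k → PBond P k → ℝ), (∀ p b, |χb p b| ≤ 1) →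
      (∀ p b, (supDist p.src b.src : ℝ) ≤ r / 8 + 2 → χb p b = 1) →
        Ineq555 (TPlaq P k) (PBond P k)
          (fun p b => (∑ p', (trunc pdist r
              (fun p q => sigmaTorus (P := P) hdP ((P.eta k) ^ P.d) ((P.L : ℝ) ^ k) k (toU P k (Pi.single q 1)) p) p p' -
              sigmaTorus (P := P) hdP ((P.eta k) ^ P.d) ((P.L : ℝ) ^ k) k (toU P k (Pi.single p' 1)) p) *
            curl cD (fun b' => if b' = b then (1 : ℝ) else 0) p') * χ₂ b * χb p b)
          (fun p b => (∑ p', (trunc pdist r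
              (fun p q => sigmaTorus (P := P) hdP ((P.eta k) ^ P.d) ((P.L : ℝ) ^ k) k (toU P k (Pi.single q 1)) p) p p' -
              sigmaTorus (P := P) hdP ((P.eta k) ^ P.d) ((P.L : ℝ) ^ k) k (toU P k (Pi.single p' 1)) p) *
            curl cD (fun b' => if b' = b then (1 : ℝ) else 0) p') * χ₂ b * χb p b +
            (torusEdgeCellsTo P 0 k k (Nat.zero_add k) hdP).Q
              (curl ((P.L : ℝ) ^ k) (fun b'' =>
                WithLp.ofLp (HkE P w c' k (toEj P k (Pi.single b 1))) b'' * χb p b -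
                  loc (cutoff (r / 16) (r / 8) (fun (b'' : PBond P 0) (b' : PBond P k) => distEU P k b''.src b'.src))
                    (fun b'' b' => WithLp.ofLp (HkE P w c' k (toEj P k (Pi.single b' 1))) b'') b'' b)) p * χ₂ b)
          c r := by
  obtain ⟨c₁, R₁, hc₁, h₁⟩ := ineq555_w3prime_allTori hd hL ha
  obtain ⟨c₂, R₂, hc₂, h₂⟩ := ineq555_w3corr_allTori hd hL ha
  have hm : 0 < min c₁ c₂ := lt_min hc₁ hc₂
  refine ⟨min c₁ c₂ / 2, max (max R₁ R₂) (2 / min c₁ c₂), by positivity, ?_⟩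
  intro P hPd hPL hdP k hk c' hc' w hw r hr cD hcD χ₂ hχ₂ χb hχb hbox
  have hR₁ : R₁ ≤ r := ((le_max_left _ _).trans (le_max_left _ _)).trans hr
  have hR₂ : R₂ ≤ r := ((le_max_right _ _).trans (le_max_left _ _)).trans hr
  have hr2 : 2 / min c₁ c₂ ≤ r := (le_max_right _ _).trans hr
  have hr0 : 0 ≤ r := le_trans (by positivity) hr2
  have hmr : 1 ≤ min c₁ c₂ / 2 * r := by
    rw [div_le_iff₀ hm] at hr2; linarith
  have he₁ : Real.exp (-(c₁ * r)) ≤ Real.exp (-(min c₁ c₂ * r)) :=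
    Real.exp_le_exp.2 (by nlinarith [min_le_left c₁ c₂])
  have he₂ : Real.exp (-(c₂ * r)) ≤ Real.exp (-(min c₁ c₂ * r)) :=
    Real.exp_le_exp.2 (by nlinarith [min_le_right c₁ c₂])
  have htwo : 2 * Real.exp (-(min c₁ c₂ * r)) ≤ Real.exp (-(min c₁ c₂ / 2 * r)) := by
    have h2 : (2 : ℝ) ≤ Real.exp (min c₁ c₂ / 2 * r) := by linarith [Real.add_one_le_exp (min c₁ c₂ / 2 * r)]
    calc 2 * Real.exp (-(min c₁ c₂ * r)) ≤ Real.exp (min c₁ c₂ / 2 * r) * Real.exp (-(min c₁ c₂ * r)) :=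
          mul_le_mul_of_nonneg_right h2 (Real.exp_pos _).le
      _ = Real.exp (-(min c₁ c₂ / 2 * r)) := by rw [← Real.exp_add]; ring_nf
  have hone : Real.exp (-(min c₁ c₂ * r)) ≤ Real.exp (-(min c₁ c₂ / 2 * r)) := by
    linarith [Real.exp_pos (-(min c₁ c₂ * r))]
  refine ineq555_of_members
    (fun p b => ((h₁ P hPd hPL hdP k hk r hR₁ cD hcD χ₂ hχ₂ χb hχb p b).trans he₁).trans hone) fun p b => ?_
  refine (abs_add_le _ _).trans ?_
  have hA := (h₁ P hPd hPL hdP k hk r hR₁ cD hcD χ₂ hχ₂ χb hχb p b).trans he₁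
  have hB := (h₂ P hPd hPL hdP k hk c' hc' w hw r hR₂ χ₂ hχ₂ χb hχb hbox p b).trans he₂
  linarith

end

end Literature.MathematicalPhysics.QuantumFieldTheory.BalabanImbrieJaffe1984to88.BIJ88Sect5KernelsAllTori
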